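import Literature.MathematicalPhysics.QuantumFieldTheory.Balaban1983to89.B9Thm31GreenPrimeGradientL2BoundZd
import Literature.MathematicalPhysics.QuantumFieldTheory.Balaban1983to89.B9Thm31GpDecayOfCoerciveZd

/-!
# `Balaban1983to89.B9Thm31FriedrichsCoerciveZd` — [Balaban1985BackgroundPropagators] THM 3.1 p. 397 ∕ THM 3.11 p. 416 («Δ′_a, G′ … positive definite. This is obvious») and
# [Balaban1984PropagatorsII] p. 226 («bounded from below by a positive constant»), MADE EXPLICIT AT THE `ℤᵈ × 𝔸` CARRIER FOR EVERY UNITARY BACKGROUND: THE COVARIANT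
# FRIEDRICHS INEQUALITY `⟨f, f⟩_τ ≤ (wη)²·Σ_x |(D^η_{U₀,μ} f)(x)|²_τ` for `f ∈ L²(Ω₀, ·)`, `Ω₀` of width `≤ w` in the direction `μ` — unitary transports are
# `|·|_τ`-isometries, so the telescoping needs NO small field — hence `(wη)⁻²·⟨f, f⟩_τ ≤ ⟨f, Ω₀Δ′_a(U₀)Ω₀ f⟩_τ` with an EXPLICIT constant, at EVERY unitary `U₀`,
# replacing the compactness constant of this seat's `B9Thm31CoercivePrimeCompactZd` (which needed the regime and gave no number)

statement-level skeleton of published theorems with citation tags; proofs where landed; nothing here is a claim about the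
Yang–Mills mass gap

`[Balaban1985BackgroundPropagators]` ("B9", CMP **99** (1985) 389–434) p. 394 (3.23)–(3.24) (the form `Σ|D^η_U λ|² + Σ_j a_j(Lʲη)^{d−2}Σ|Q′_jλ|²` on `L²(Ω₀, 𝔤)`), p. 397
Thm 3.1, p. 416 Thm 3.11; `[Balaban1984PropagatorsII]` ("[4]", CMP **96**) p. 226, (2.22); `[Balaban1985RegularSpaces]` ("B8") (1.1) p. 76 (the covariant derivative
`(D^η_{U,μ}F)(x) = η⁻¹(R(U(x, x+ηe_μ))F(x+ηe_μ) − F(x))`).  The Friedrichs (Dirichlet–Poincaré) inequality is folklore; its covariant form uses only `|R(u)a|_τ = |a|_τ`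
for unitary `u` (tracial `τ`).  The constant `(wη)⁻²` depends on the WIDTH of `Ω₀` (print's Thm 3.1 constant does not — it uses the multi-level penalty, Sect. B);
what is gained here is a NUMBER valid at EVERY unitary background.  PDF held: `paper:balaban1985-cmp99-background-propagators` pp. 394–397, 416 (re-read 2026-08-28).

CITATION HEADER (lean-in-tree rule).  Cell `pub-ymgap` (YM Track A, D-0062 ∕ D-0149), node N06 = [B9], width seat `pub-ymgap-dag-n06-w4` (g4), CLAIM-12 ∕ INTENT-12.  Inputs BY NAME:
dag-n06-w2 g4's `B9Eq342CombesThomasFormZd` (`fnorm`, `fnorm_sq`, `fnorm_smul`, `fnorm_sub_le`∕`fnorm_add_le`, `formE_self_eq_sum_sq`) and `B9Thm31GpDecayOfCoerciveZd.fnorm_conjR_of_unitary`,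
this seat's g4 `B9Thm31GreenPrimeGradientL2BoundZd.gradEnergy_le_formE_deltaPrimeADom`, g2 `B9Eq324DeltaPrimeAZd` (`deltaPrimeADom`, `GpZd`), `B8Ineq132.covDerivFwd`, Mathlib
`sq_sum_le_card_mul_sum_sq`.

WHAT IS PROVED (kernel, 0 sorry; theorems only — no `def`, `instance`, `notation`; faithful Hermitian tracial `τ` a PARAMETER, `η ≠ 0`).
* §1 (one line, EVERY unitary `U₀`) `fnorm_le_step` (`|F(x)|_τ ≤ |F(x+e_μ)|_τ + |η|·|(D^η_{U₀,μ}F)(x)|_τ`), ★ `fnorm_le_sum_covDerivFwd` (telescoping: `|F(x)|_τ ≤ |F(x + n·e_μ)|_τ +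
  |η|·Σ_{k<n} |(D^η_{U₀,μ}F)(x + k·e_μ)|_τ`), ★ `fnorm_sq_le_of_vanish` (`F(x + n·e_μ) = 0` ⟹ `|F(x)|²_τ ≤ η²·n·Σ_{k<n} |(D^η_{U₀,μ}F)(x + k·e_μ)|²_τ`).
* §2 (`Ω₀ = s` with `lo ≤ y_μ ≤ hi` for `y ∈ s`, `w = hi − lo + 1`) ★★★ `formE_self_le_width_sq_mul_gradEnergy` (THE COVARIANT FRIEDRICHS INEQUALITY:
  `⟨f, f⟩_τ ≤ (wη)²·Σ_ν Σ_x |(D^η_{U₀,ν} f)(x)|²_τ` for every `f ∈ L²(Ω₀, ·)` and EVERY unitary `U₀`).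
* §4 (cube member) `cubeMember_Ω0_bounds`, `sqHi_sub_sqLo`, `sqLo_le_sqHi`, ★★★★ `formE_deltaPrimeADom_coercive_cubeMember` (on `L²(□₀, ·)`: the explicit width
  `w = Lᵏ·M + 2ρ·gs L k`, every unitary `U₀`, `1 ≤ ρ`), ★★★★★ `formE_deltaPrimeADom_coercive_cubeMember_uniform` (with `η·Lᵏ ≤ 1`: the MEMBER-UNIFORM constant
  `((M + 4ρ)²)⁻¹` — one number for the whole cube family, every unitary `U₀`), ★★★★ `formE_GpZd_self_le_cubeMember_uniform` (`‖G′(U₀)f‖²_τ ≤ (M + 4ρ)⁴‖f‖²_τ`),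
  ★★★★ `gradEnergy_GpZd_le_cubeMember_uniform` (`Σ|D G′f|²_τ ≤ (M + 4ρ)²‖f‖²_τ`).
* §3 ★★★★ `formE_deltaPrimeADom_coercive_width` (`(wη)⁻²·⟨f, f⟩_τ ≤ ⟨f, Ω₀Δ′_a(U₀)Ω₀ f⟩_τ` for EVERY unitary `U₀`, `a ≥ 0` — dag-n06-w2 g4's `hco` SHAPE with an EXPLICIT
  constant), ★★★ `formE_GpZd_self_le_width` (`‖G′(U₀)f‖²_τ ≤ (wη)⁴‖f‖²_τ`), ★★★ `gradEnergy_GpZd_le_width` (`Σ|D(G′f)|²_τ ≤ (wη)²‖f‖²_τ`) — every unitary `U₀`, no regime.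

HONEST SCOPE.  The constant depends on the WIDTH `w` of `Ω₀` (for a cube member: its side), unlike print's Thm 3.1 constant (uniform in the cube, from the penalty
`Q′*aQ′` and Sect. B); no decay; `τ` a PARAMETER; count-neutral helper (`--supports` the K1 item of record); N05 ∕ N06 NOT discharged; K1 NOT closed; one finite `𝕋⁴`
programme at fixed `ε`, Bałaban as printed; R4 closes only the conditional finite-`𝕋⁴` rung `BalabanLadder.UV` — nothing continuum ∕ ℝ⁴ ∕ OS ∕ mass gap ∕ Clay.  Unit
`pub-ymgap-dag-n06-w4` (g4), 2026-08-28.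
-/

noncomputable section

namespace Literature.MathematicalPhysics.QuantumFieldTheory.Balaban1983to89.B9Thm31FriedrichsCoerciveZd

open Filter Topology
open B7Prop1Explicit
open B7Eq78Linearization (conjR conjR_apply)
open B7Prop2Explicit (unitaryUnits)
open B8Ineq132 (covDerivFwd)
open B8Eq131Cubes (sqLo sqHi gs one_le_gs cube bLo bHi margin_own)
open B8Eq131CubesAdmissible (cubeFam cubeFam_false_zero)
open B8LeafModelZd (ZdIdx)
open B9Thm311PosDefOpenZd (cubeMember_Ω0_finite)
open B9Eq321LandauProjectionZd (suppSub formE formE_isSymm)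
open B9Eq324DeltaPrimeAZd (deltaPrimeADom GpZd deltaPrimeADom_GpZd)
open B9Eq342CombesThomasFormZd (fnorm fnorm_nonneg fnorm_sq fnorm_smul fnorm_add_le fnorm_zero formE_self_eq_sum_sq formE_self_nonneg')
open B9Thm31GpDecayOfCoerciveZd (fnorm_conjR_of_unitary fnorm_neg' fnorm_sub_le)
open B9Thm311InverseL2BoundsZd (formE_GpZd_self_le_of_coercive)
open B9Thm31GreenPrimeGradientL2BoundZd (gradEnergy_le_formE_deltaPrimeADom gradEnergy_GpZd_le_of_coercive gradEnergy_nonneg)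

export B7Prop1Explicit (Site)

variable {d : ℕ} {𝔸 : Type*} [CStarAlgebra 𝔸]
variable (τ : 𝔸 →ₗ[ℂ] ℂ) (hτp : ∀ a : 𝔸, a ≠ 0 → 0 < (τ (star a * a)).re)
  (hτt : ∀ a b : 𝔸, τ (a * b) = τ (b * a)) (hτs : ∀ a : 𝔸, τ (star a) = starRingEnd ℂ (τ a))

/-! ## §1  Covariant telescoping along one lattice direction (every unitary background) -/

section Telescoping

variable {η : ℝ} {U₀ : Site d → Fin d → 𝔸ˣ}

include hτp hτt hτs in
/-- **ONE STEP**: `|F(x)|_τ ≤ |F(x + e_μ)|_τ + |η|·|(D^η_{U₀,μ}F)(x)|_τ` at a unitary background (`F(x) = R(U₀(x,μ))F(x+e_μ) − η·(D^η_{U₀,μ}F)(x)` and `|R(u)a|_τ = |a|_τ`).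
[cite: Balaban1985RegularSpaces, (1.1) p.76; Balaban1985BackgroundPropagators, (3.28) p.395] -/
theorem fnorm_le_step (hη : η ≠ 0) (hU : ∀ (x : Site d) (κ : Fin d), U₀ x κ ∈ unitaryUnits 𝔸) (F : Site d → 𝔸) (μ : Fin d) (x : Site d) :
    fnorm τ (F x) ≤ fnorm τ (F (x + e μ)) + |η| * fnorm τ (covDerivFwd η U₀ μ F x) := by
  have hid : F x = conjR (U₀ x μ) (F (x + e μ)) - η • covDerivFwd η U₀ μ F x := by
    rw [covDerivFwd, smul_smul, mul_inv_cancel₀ hη, one_smul, sub_sub_cancel]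
  calc fnorm τ (F x) = fnorm τ (conjR (U₀ x μ) (F (x + e μ)) - η • covDerivFwd η U₀ μ F x) := by rw [← hid]
    _ ≤ fnorm τ (conjR (U₀ x μ) (F (x + e μ))) + fnorm τ (η • covDerivFwd η U₀ μ F x) := fnorm_sub_le τ hτp hτs _ _
    _ = fnorm τ (F (x + e μ)) + |η| * fnorm τ (covDerivFwd η U₀ μ F x) := by
        rw [fnorm_conjR_of_unitary τ hτt (hU x μ), fnorm_smul]

include hτp hτt hτs in
/-- ★ **COVARIANT TELESCOPING**: `|F(x)|_τ ≤ |F(x + n·e_μ)|_τ + |η|·Σ_{k<n} |(D^η_{U₀,μ}F)(x + k·e_μ)|_τ` at every unitary background.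
[cite: Balaban1985RegularSpaces, (1.1) p.76; Balaban1985BackgroundPropagators, (3.23) p.394] -/
theorem fnorm_le_sum_covDerivFwd (hη : η ≠ 0) (hU : ∀ (x : Site d) (κ : Fin d), U₀ x κ ∈ unitaryUnits 𝔸) (F : Site d → 𝔸) (μ : Fin d) (x : Site d) :
    ∀ n : ℕ, fnorm τ (F x) ≤ fnorm τ (F (x + (n : ℤ) • e μ)) + |η| * ∑ k ∈ Finset.range n, fnorm τ (covDerivFwd η U₀ μ F (x + (k : ℤ) • e μ))
  | 0 => by simp
  | n + 1 => by
    have ih := fnorm_le_sum_covDerivFwd hη hU F μ x n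
    have hstep := fnorm_le_step τ hτp hτt hτs hη hU F μ (x + (n : ℤ) • e μ)
    have hx : x + (n : ℤ) • e μ + e μ = x + ((n + 1 : ℕ) : ℤ) • e μ := by
      rw [Nat.cast_succ, add_smul, one_smul, add_assoc]
    rw [hx] at hstep
    rw [Finset.sum_range_succ, mul_add]
    linarith

include hτp hτt hτs in
/-- ★ **`F(x + n·e_μ) = 0` ⟹ `|F(x)|²_τ ≤ η²·n·Σ_{k<n} |(D^η_{U₀,μ}F)(x + k·e_μ)|²_τ`** (telescoping + Cauchy–Schwarz).
[cite: Balaban1985BackgroundPropagators, (3.23) p.394; Balaban1984PropagatorsII, p.226] -/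
theorem fnorm_sq_le_of_vanish (hη : η ≠ 0) (hU : ∀ (x : Site d) (κ : Fin d), U₀ x κ ∈ unitaryUnits 𝔸) (F : Site d → 𝔸) (μ : Fin d) (x : Site d)
    {n : ℕ} (hzero : F (x + (n : ℤ) • e μ) = 0) :
    fnorm τ (F x) ^ 2 ≤ η ^ 2 * n * ∑ k ∈ Finset.range n, fnorm τ (covDerivFwd η U₀ μ F (x + (k : ℤ) • e μ)) ^ 2 := by
  have h := fnorm_le_sum_covDerivFwd τ hτp hτt hτs hη hU F μ x n
  rw [hzero, fnorm_zero, zero_add] at h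
  have hS : 0 ≤ ∑ k ∈ Finset.range n, fnorm τ (covDerivFwd η U₀ μ F (x + (k : ℤ) • e μ)) := Finset.sum_nonneg fun k _ => fnorm_nonneg τ _
  have h2 : fnorm τ (F x) ^ 2 ≤ (|η| * ∑ k ∈ Finset.range n, fnorm τ (covDerivFwd η U₀ μ F (x + (k : ℤ) • e μ))) ^ 2 :=
    pow_le_pow_left₀ (fnorm_nonneg τ _) h 2
  have hCS := sq_sum_le_card_mul_sum_sq (s := Finset.range n) (f := fun k => fnorm τ (covDerivFwd η U₀ μ F (x + (k : ℤ) • e μ)))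
  rw [Finset.card_range] at hCS
  calc fnorm τ (F x) ^ 2 ≤ (|η| * ∑ k ∈ Finset.range n, fnorm τ (covDerivFwd η U₀ μ F (x + (k : ℤ) • e μ))) ^ 2 := h2
    _ = η ^ 2 * (∑ k ∈ Finset.range n, fnorm τ (covDerivFwd η U₀ μ F (x + (k : ℤ) • e μ))) ^ 2 := by rw [mul_pow, sq_abs]
    _ ≤ η ^ 2 * (n * ∑ k ∈ Finset.range n, fnorm τ (covDerivFwd η U₀ μ F (x + (k : ℤ) • e μ)) ^ 2) :=
        mul_le_mul_of_nonneg_left hCS (sq_nonneg η)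
    _ = η ^ 2 * n * ∑ k ∈ Finset.range n, fnorm τ (covDerivFwd η U₀ μ F (x + (k : ℤ) • e μ)) ^ 2 := by ring

end Telescoping

/-! ## §2  The covariant Friedrichs inequality on `L²(Ω₀, ·)` for `Ω₀` of bounded width -/

section Friedrichs

variable {η : ℝ} {U₀ : Site d → Fin d → 𝔸ˣ}

include hτp in
/-- the gradient-energy summand is the square of the `τ`-size. [cite: Balaban1985BackgroundPropagators, (3.23) p.394 (bookkeeping)] -/
theorem re_trace_eq_fnorm_sq (a : 𝔸) : (τ (star a * a)).re = fnorm τ a ^ 2 := (fnorm_sq hτp a).symm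

include hτp hτt hτs in
/-- ★★★ **THE COVARIANT FRIEDRICHS INEQUALITY AT EVERY UNITARY BACKGROUND**: if every site of `Ω₀ = s` has `μ`-coordinate in `[lo, hi]` and `w = hi − lo + 1`, then for
every `f ∈ L²(Ω₀, ·)` (vanishing off `Ω₀`) `⟨f, f⟩_τ ≤ (wη)²·Σ_ν Σ_x |(D^η_{U₀,ν} f)(x)|²_τ` — along the `μ`-line through `x ∈ Ω₀` the field vanishes after at most `w` steps,
so `|f(x)|²_τ ≤ η²w·Σ_{k<w} |(D^η_{U₀,μ}f)(x + k·e_μ)|²_τ`, and each bond is met at most `w` times. [cite: Balaban1985BackgroundPropagators, (3.23) p.394, Thm 3.11 p.416; Balaban1984PropagatorsII, p.226 (the positive lower bound), (2.22)] -/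
theorem formE_self_le_width_sq_mul_gradEnergy (hη : η ≠ 0) (hU : ∀ (x : Site d) (κ : Fin d), U₀ x κ ∈ unitaryUnits 𝔸) {s : Finset (Site d)}
    (μ : Fin d) {lo hi : ℤ} (hlohi : lo ≤ hi) (hbox : ∀ y ∈ s, lo ≤ y μ ∧ y μ ≤ hi) (f : suppSub (𝔸 := 𝔸) s) :
    formE τ s f f ≤ (((hi - lo + 1 : ℤ) : ℝ) * η) ^ 2 *
      ∑ ν : Fin d, ∑ᶠ x, (τ (star (covDerivFwd η U₀ ν (f : Site d → 𝔸) x) * covDerivFwd η U₀ ν (f : Site d → 𝔸) x)).re := by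
  classical
  -- the width as a natural number
  obtain ⟨w, hw⟩ : ∃ w : ℕ, (w : ℤ) = hi - lo + 1 := ⟨(hi - lo + 1).toNat, by rw [Int.toNat_of_nonneg (by omega)]⟩
  set F : Site d → 𝔸 := (f : Site d → 𝔸) with hF
  set g : Site d → ℝ := fun z => fnorm τ (covDerivFwd η U₀ μ F z) ^ 2 with hg
  have hg0 : ∀ z, 0 ≤ g z := fun z => sq_nonneg _
  -- the gradient energy in direction `μ` dominates every finite partial sum of `g`
  have hsuppF : (Function.support F).Finite := (s.finite_toSet).subset fun z hz => by
    by_contra hzs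
    exact hz (f.2 z hzs)
  have hsuppD : (Function.support fun z => covDerivFwd η U₀ μ F z).Finite := by
    refine (hsuppF.union (hsuppF.image fun z => z - e μ)).subset fun z hz => ?_
    rw [Function.mem_support] at hz
    by_contra hzz
    simp only [Set.mem_union, Function.mem_support, Set.mem_image, not_or, not_not, not_exists, not_and] at hzz
    apply hz
    rw [covDerivFwd, hzz.1]
    have h2 : F (z + e μ) = 0 := by
      by_contra hne
      exact hzz.2 (z + e μ) hne (by simp)
    rw [h2, conjR_apply, mul_zero, zero_mul, sub_zero, smul_zero]
  have hsuppg : (Function.support g).Finite := hsuppD.subset fun z hz => by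
    rw [Function.mem_support] at hz ⊢
    intro h0
    exact hz (show fnorm τ (covDerivFwd η U₀ μ F z) ^ 2 = 0 by rw [h0, fnorm_zero]; ring)
  have hfin_le : ∀ T : Finset (Site d), ∑ z ∈ T, g z ≤ ∑ᶠ z, g z := by
    intro T
    rw [finsum_eq_sum_of_support_subset g (s := T ∪ hsuppg.toFinset) (fun z hz => by
      rw [Finset.coe_union, Set.mem_union, Set.Finite.coe_toFinset]; exact Or.inr hz)]
    exact Finset.sum_le_sum_of_subset_of_nonneg Finset.subset_union_left fun z _ _ => hg0 z
  -- pointwise Friedrichs: `|f(x)|² ≤ η² w Σ_{k<w} g(x + k e_μ)` for `x ∈ s`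
  have hpt : ∀ x ∈ s, fnorm τ (F x) ^ 2 ≤ η ^ 2 * w * ∑ k ∈ Finset.range w, g (x + (k : ℤ) • e μ) := by
    intro x hx
    -- `n = hi + 1 − x μ ≤ w` steps leave the box
    obtain ⟨n, hn⟩ : ∃ n : ℕ, (n : ℤ) = hi + 1 - x μ := ⟨(hi + 1 - x μ).toNat, by rw [Int.toNat_of_nonneg (by have := (hbox x hx).2; omega)]⟩
    have hnw : n ≤ w := by have := (hbox x hx).1; omega
    have hout : x + (n : ℤ) • e μ ∉ s := by
      intro hmem
      have h1 := (hbox _ hmem).2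
      simp only [Pi.add_apply, Pi.smul_apply, e_apply, if_true, smul_eq_mul, mul_one] at h1
      omega
    have hzero : F (x + (n : ℤ) • e μ) = 0 := f.2 _ hout
    have h := fnorm_sq_le_of_vanish τ hτp hτt hτs hη hU F μ x hzero
    refine h.trans ?_
    have hmono : ∑ k ∈ Finset.range n, g (x + (k : ℤ) • e μ) ≤ ∑ k ∈ Finset.range w, g (x + (k : ℤ) • e μ) :=
      Finset.sum_le_sum_of_subset_of_nonneg (Finset.range_mono hnw) fun k _ _ => hg0 _
    have hnw' : (n : ℝ) ≤ w := by exact_mod_cast hnw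
    have hS : 0 ≤ ∑ k ∈ Finset.range n, g (x + (k : ℤ) • e μ) := Finset.sum_nonneg fun k _ => hg0 _
    calc η ^ 2 * n * ∑ k ∈ Finset.range n, fnorm τ (covDerivFwd η U₀ μ F (x + (k : ℤ) • e μ)) ^ 2
        = η ^ 2 * n * ∑ k ∈ Finset.range n, g (x + (k : ℤ) • e μ) := rfl
      _ ≤ η ^ 2 * w * ∑ k ∈ Finset.range w, g (x + (k : ℤ) • e μ) := by
          have := sq_nonneg η
          nlinarith [mul_nonneg this hS, mul_le_mul hnw' hmono hS (Nat.cast_nonneg w)]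
  -- sum over `s` and swap: each shifted copy of `s` contributes at most `Σᶠ g`
  have hsum : formE τ s f f ≤ η ^ 2 * w * (w * ∑ᶠ z, g z) := by
    rw [formE_self_eq_sum_sq hτp f]
    calc ∑ x ∈ s, fnorm τ (F x) ^ 2 ≤ ∑ x ∈ s, η ^ 2 * w * ∑ k ∈ Finset.range w, g (x + (k : ℤ) • e μ) := Finset.sum_le_sum hpt
      _ = η ^ 2 * w * ∑ k ∈ Finset.range w, ∑ x ∈ s, g (x + (k : ℤ) • e μ) := by rw [← Finset.mul_sum, Finset.sum_comm]
      _ ≤ η ^ 2 * w * ∑ k ∈ Finset.range w, ∑ᶠ z, g z := by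
          refine mul_le_mul_of_nonneg_left (Finset.sum_le_sum fun k _ => ?_) (by positivity)
          rw [← Finset.sum_image (f := g) (s := s) (g := fun x => x + (k : ℤ) • e μ) fun x _ y _ h => add_right_cancel h]
          exact hfin_le _
      _ = η ^ 2 * w * (w * ∑ᶠ z, g z) := by rw [Finset.sum_const, Finset.card_range, nsmul_eq_mul]
  -- the direction-`μ` energy is one summand of the full gradient energy
  have hdir : ∑ᶠ z, g z ≤ ∑ ν : Fin d, ∑ᶠ x, (τ (star (covDerivFwd η U₀ ν F x) * covDerivFwd η U₀ ν F x)).re := by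
    have heq : ∑ᶠ z, g z = ∑ᶠ x, (τ (star (covDerivFwd η U₀ μ F x) * covDerivFwd η U₀ μ F x)).re :=
      finsum_congr fun z => (re_trace_eq_fnorm_sq τ hτp _).symm
    rw [heq]
    exact Finset.single_le_sum (f := fun ν => ∑ᶠ x, (τ (star (covDerivFwd η U₀ ν F x) * covDerivFwd η U₀ ν F x)).re)
      (fun ν _ => finsum_nonneg fun x => by rw [re_trace_eq_fnorm_sq τ hτp]; exact sq_nonneg _) (Finset.mem_univ μ)
  have hG0 : 0 ≤ ∑ᶠ z, g z := finsum_nonneg hg0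
  calc formE τ s f f ≤ η ^ 2 * w * (w * ∑ᶠ z, g z) := hsum
    _ = (((hi - lo + 1 : ℤ) : ℝ) * η) ^ 2 * ∑ᶠ z, g z := by rw [← hw]; push_cast; ring
    _ ≤ (((hi - lo + 1 : ℤ) : ℝ) * η) ^ 2 * ∑ ν : Fin d, ∑ᶠ x, (τ (star (covDerivFwd η U₀ ν F x) * covDerivFwd η U₀ ν F x)).re :=
        mul_le_mul_of_nonneg_left hdir (sq_nonneg _)

end Friedrichs

/-! ## §3  An EXPLICIT coercivity constant for `Ω₀Δ′_a(U₀)Ω₀` at every unitary background, and the explicit bounds for `G′(U₀)` -/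

section Explicit

variable [FiniteDimensional ℝ 𝔸] {L : ℕ} {η : ℝ}

include hτt hτs in
/-- ★★★★ **THEOREM 3.1 ∕ 3.11 FOR `Δ′_a` WITH AN EXPLICIT CONSTANT AT EVERY UNITARY BACKGROUND**: if `Ω₀ = s` has `μ`-width `w = hi − lo + 1`, then for EVERY unitary `U₀`,
every `a ≥ 0` and every `f ∈ L²(Ω₀, ·)`: `(wη)⁻²·⟨f, f⟩_τ ≤ ⟨f, Ω₀Δ′_a(U₀)Ω₀ f⟩_τ` — dag-n06-w2 g4's `hco` shape with `c = (wη)⁻²`; no regime, no compactness.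
[cite: Balaban1985BackgroundPropagators, Thm 3.1 p.397, Thm 3.11 p.416, (3.23)–(3.24) p.394; Balaban1984PropagatorsII, p.226] -/
theorem formE_deltaPrimeADom_coercive_width (hη : η ≠ 0) (m : ℕ) {a : ℕ → ℝ} (ha : ∀ j, 0 ≤ a j) (Λ : ℕ → Finset (Site d)) {s : Finset (Site d)}
    (μ : Fin d) {lo hi : ℤ} (hlohi : lo ≤ hi) (hbox : ∀ y ∈ s, lo ≤ y μ ∧ y μ ≤ hi)
    {U₀ : Site d → Fin d → 𝔸ˣ} (hU : ∀ (x : Site d) (κ : Fin d), U₀ x κ ∈ unitaryUnits 𝔸) (f : suppSub (𝔸 := 𝔸) s) :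
    ((((hi - lo + 1 : ℤ) : ℝ) * η) ^ 2)⁻¹ * formE τ s f f ≤ formE τ s f (deltaPrimeADom L U₀ η τ hτp m a Λ s f) := by
  have hF := formE_self_le_width_sq_mul_gradEnergy τ hτp hτt hτs hη hU μ hlohi hbox f
  have hgrad := gradEnergy_le_formE_deltaPrimeADom τ hτp hτt hτs m ha Λ s hU f (L := L) (η := η)
  have hpos : 0 < (((hi - lo + 1 : ℤ) : ℝ) * η) ^ 2 := by
    have h1 : (0 : ℝ) < ((hi - lo + 1 : ℤ) : ℝ) := by exact_mod_cast (by omega : (0 : ℤ) < hi - lo + 1)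
    have h2 : (((hi - lo + 1 : ℤ) : ℝ) * η) ≠ 0 := mul_ne_zero h1.ne' hη
    positivity
  rw [inv_mul_le_iff₀ hpos]
  exact hF.trans (mul_le_mul_of_nonneg_left hgrad hpos.le)

include hτt hτs in
/-- ★★★ **`‖G′(U₀)f‖²_τ ≤ (wη)⁴·‖f‖²_τ` AT EVERY UNITARY BACKGROUND** (explicit `n = 0` bound; `0 < d`, `a ≥ 0`).
[cite: Balaban1985BackgroundPropagators, Thm 3.1 p.397, (3.42) p.397; Balaban1984PropagatorsII, (2.22) p.226] -/
theorem formE_GpZd_self_le_width (hd : 0 < d) (hη : η ≠ 0) (m : ℕ) {a : ℕ → ℝ} (ha : ∀ j, 0 ≤ a j) (Λ : ℕ → Finset (Site d)) {s : Finset (Site d)}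
    (μ : Fin d) {lo hi : ℤ} (hlohi : lo ≤ hi) (hbox : ∀ y ∈ s, lo ≤ y μ ∧ y μ ≤ hi)
    {U₀ : Site d → Fin d → 𝔸ˣ} (hU : ∀ (x : Site d) (κ : Fin d), U₀ x κ ∈ unitaryUnits 𝔸) (f : suppSub (𝔸 := 𝔸) s) :
    formE τ s (GpZd L U₀ η τ hτp m a Λ s hd hη hτt hτs hU ha f) (GpZd L U₀ η τ hτp m a Λ s hd hη hτt hτs hU ha f) ≤
      (((((hi - lo + 1 : ℤ) : ℝ) * η) ^ 2)⁻¹)⁻¹ ^ 2 * formE τ s f f := by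
  have hpos : 0 < ((((hi - lo + 1 : ℤ) : ℝ) * η) ^ 2)⁻¹ := by
    have h1 : (0 : ℝ) < ((hi - lo + 1 : ℤ) : ℝ) := by exact_mod_cast (by omega : (0 : ℤ) < hi - lo + 1)
    have h2 : (((hi - lo + 1 : ℤ) : ℝ) * η) ≠ 0 := mul_ne_zero h1.ne' hη
    positivity
  exact formE_GpZd_self_le_of_coercive τ hτp hτt hτs hd hη m ha Λ s hU hpos
    (fun g => formE_deltaPrimeADom_coercive_width τ hτp hτt hτs hη m ha Λ μ hlohi hbox hU g) f

include hτt hτs in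
/-- ★★★ **`Σ_ν Σ_x |(D^η_{U₀,ν}G′(U₀)f)(x)|²_τ ≤ (wη)²·‖f‖²_τ` AT EVERY UNITARY BACKGROUND** (explicit `n = 1` bound).
[cite: Balaban1985BackgroundPropagators, Thm 3.1 p.397, (3.42) p.397 (n = 1); Balaban1984PropagatorsII, (2.22) p.226] -/
theorem gradEnergy_GpZd_le_width (hd : 0 < d) (hη : η ≠ 0) (m : ℕ) {a : ℕ → ℝ} (ha : ∀ j, 0 ≤ a j) (Λ : ℕ → Finset (Site d)) {s : Finset (Site d)}
    (μ : Fin d) {lo hi : ℤ} (hlohi : lo ≤ hi) (hbox : ∀ y ∈ s, lo ≤ y μ ∧ y μ ≤ hi)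
    {U₀ : Site d → Fin d → 𝔸ˣ} (hU : ∀ (x : Site d) (κ : Fin d), U₀ x κ ∈ unitaryUnits 𝔸) (f : suppSub (𝔸 := 𝔸) s) :
    ∑ ν : Fin d, ∑ᶠ x, (τ (star (covDerivFwd η U₀ ν (GpZd L U₀ η τ hτp m a Λ s hd hη hτt hτs hU ha f : Site d → 𝔸) x) *
        covDerivFwd η U₀ ν (GpZd L U₀ η τ hτp m a Λ s hd hη hτt hτs hU ha f : Site d → 𝔸) x)).re ≤
      ((((hi - lo + 1 : ℤ) : ℝ) * η) ^ 2)⁻¹⁻¹ * formE τ s f f := by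
  have hpos : 0 < ((((hi - lo + 1 : ℤ) : ℝ) * η) ^ 2)⁻¹ := by
    have h1 : (0 : ℝ) < ((hi - lo + 1 : ℤ) : ℝ) := by exact_mod_cast (by omega : (0 : ℤ) < hi - lo + 1)
    have h2 : (((hi - lo + 1 : ℤ) : ℝ) * η) ≠ 0 := mul_ne_zero h1.ne' hη
    positivity
  exact gradEnergy_GpZd_le_of_coercive τ hτp hτt hτs hd hη m ha Λ s hU hpos
    (fun g => formE_deltaPrimeADom_coercive_width τ hτp hτt hτs hη m ha Λ μ hlohi hbox hU g) f

end Explicit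

/-! ## §4  At a cube member: `Ω₀ = □₀` has width `Lᵏ·M + 2ρ·gs L k` in every direction -/

section CubeMember

variable [FiniteDimensional ℝ 𝔸] {L : ℕ}

/-- the `μ`-coordinates of the sites of `□₀` lie in `[sqLo, sqHi]`. [cite: Balaban1985RegularSpaces, (1.131) p.99, p.98 (the cubes `□_j`)] -/
theorem cubeMember_Ω0_bounds (i : ZdIdx d L) {a : Site d} {Mc ρ : ℕ} (hΩ : i.Ω = cubeFam false L a Mc ρ i.k) (μ : Fin d) :
    ∀ y ∈ (cubeMember_Ω0_finite i hΩ).toFinset, sqLo L a ρ i.k 0 μ ≤ y μ ∧ y μ ≤ sqHi L a Mc ρ i.k 0 μ := by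
  intro y hy
  rw [Set.Finite.mem_toFinset] at hy
  have hy' : y ∈ cubeFam false L a Mc ρ i.k 0 := hΩ ▸ hy
  rw [cubeFam_false_zero] at hy'
  exact hy' μ

/-- the width of `□₀` in every direction: `sqHi − sqLo + 1 = Lᵏ·M + 2ρ·gs L k`. [cite: Balaban1985RegularSpaces, p.98 (the cubes `□_j`, margins `R₁M₁Lʲη`)] -/
theorem sqHi_sub_sqLo (a : Site d) (Mc ρ k : ℕ) (μ : Fin d) :
    sqHi L a Mc ρ k 0 μ - sqLo L a ρ k 0 μ + 1 = (L : ℤ) ^ k * Mc + 2 * ρ * gs L k := by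
  simp only [sqHi, sqLo, bHi, bLo, Nat.sub_zero]
  push_cast
  ring

/-- `sqLo ≤ sqHi` as soon as `1 ≤ ρ`. [cite: Balaban1985RegularSpaces, p.98 (the cubes `□_j`)] -/
theorem sqLo_le_sqHi (a : Site d) (Mc k : ℕ) {ρ : ℕ} (hρ : 1 ≤ ρ) (μ : Fin d) : sqLo L a ρ k 0 μ ≤ sqHi L a Mc ρ k 0 μ := by
  have h := sqHi_sub_sqLo (L := L) a Mc ρ k μ
  have hgs : (1 : ℤ) ≤ gs L k := by exact_mod_cast one_le_gs L k
  have hρ' : (1 : ℤ) ≤ ρ := by exact_mod_cast hρ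
  have hM : (0 : ℤ) ≤ (L : ℤ) ^ k * Mc := by positivity
  nlinarith

include hτt hτs in
/-- ★★★★ **AT A CUBE MEMBER, FOR EVERY UNITARY BACKGROUND**: `((wη)²)⁻¹·⟨f, f⟩_τ ≤ ⟨f, Ω₀Δ′_a(U₀)Ω₀ f⟩_τ` on `L²(□₀, ·)` with the EXPLICIT width `w = Lᵏ·M + 2ρ·gs L k`
(`1 ≤ ρ`, `0 < d`, `η ≠ 0`, `a ≥ 0`; the level sets `Λ_j` are arbitrary — the penalty only helps).
[cite: Balaban1985BackgroundPropagators, Thm 3.1 p.397, Thm 3.11 p.416; Balaban1984PropagatorsII, p.226; Balaban1985RegularSpaces, (1.131) p.99] -/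
theorem formE_deltaPrimeADom_coercive_cubeMember (hd : 0 < d) (i : ZdIdx d L) (hη : i.η ≠ 0) {a : Site d} {Mc ρ : ℕ}
    (hΩ : i.Ω = cubeFam false L a Mc ρ i.k) (hρ : 1 ≤ ρ) (m : ℕ) {a₀ : ℕ → ℝ} (ha : ∀ j, 0 ≤ a₀ j) (Λ : ℕ → Finset (Site d))
    {U₀ : Site d → Fin d → 𝔸ˣ} (hU : ∀ (x : Site d) (κ : Fin d), U₀ x κ ∈ unitaryUnits 𝔸) (f : suppSub (𝔸 := 𝔸) (cubeMember_Ω0_finite i hΩ).toFinset) :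
    (((((L : ℤ) ^ i.k * Mc + 2 * ρ * gs L i.k : ℤ) : ℝ) * i.η) ^ 2)⁻¹ * formE τ _ f f ≤
      formE τ _ f (deltaPrimeADom L U₀ i.η τ hτp m a₀ Λ (cubeMember_Ω0_finite i hΩ).toFinset f) := by
  have h := formE_deltaPrimeADom_coercive_width τ hτp hτt hτs hη m ha Λ (L := L) ⟨0, hd⟩ (sqLo_le_sqHi (L := L) a Mc i.k hρ ⟨0, hd⟩)
    (cubeMember_Ω0_bounds i hΩ ⟨0, hd⟩) hU f
  rwa [sqHi_sub_sqLo] at h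

include hτt hτs in
/-- ★★★★★ **MEMBER-UNIFORM EXPLICIT CONSTANT**: at a cube member with `η·Lᵏ ≤ 1` (print: `η = L^{−k}`, the unit lattice on top) and `L ≥ 2`, `1 ≤ ρ`:
`((M + 4ρ)²)⁻¹·⟨f, f⟩_τ ≤ ⟨f, Ω₀Δ′_a(U₀)Ω₀ f⟩_τ` on `L²(□₀, ·)` for EVERY unitary `U₀` — ONE constant for the whole cube family `{□^{(k)}}_k` (it depends on `M = Mc` and
`ρ = R₁M₁` only), since the width obeys `wη = (LᵏM + 2ρ·gs L k)η ≤ (M + 4ρ)·Lᵏη ≤ M + 4ρ` (`ρ·gs L k ≤ 2ρLᵏ`, `B8Eq131Cubes.margin_own`).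
[cite: Balaban1985BackgroundPropagators, Thm 3.1 p.397 («constants … depend on d and L only» — here: on M, R₁M₁), Thm 3.11 p.416; Balaban1984PropagatorsII, p.226; Balaban1985RegularSpaces, p.98, (1.131) p.99] -/
theorem formE_deltaPrimeADom_coercive_cubeMember_uniform (hd : 0 < d) (hL : 2 ≤ L) (i : ZdIdx d L) {a : Site d} {Mc ρ : ℕ}
    (hΩ : i.Ω = cubeFam false L a Mc ρ i.k) (hρ : 1 ≤ ρ) (hηk : i.η * (L : ℝ) ^ i.k ≤ 1) (m : ℕ) {a₀ : ℕ → ℝ} (ha : ∀ j, 0 ≤ a₀ j)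
    (Λ : ℕ → Finset (Site d)) {U₀ : Site d → Fin d → 𝔸ˣ} (hU : ∀ (x : Site d) (κ : Fin d), U₀ x κ ∈ unitaryUnits 𝔸)
    (f : suppSub (𝔸 := 𝔸) (cubeMember_Ω0_finite i hΩ).toFinset) :
    (((Mc : ℝ) + 4 * ρ) ^ 2)⁻¹ * formE τ _ f f ≤ formE τ _ f (deltaPrimeADom L U₀ i.η τ hτp m a₀ Λ (cubeMember_Ω0_finite i hΩ).toFinset f) := by
  have h := formE_deltaPrimeADom_coercive_cubeMember τ hτp hτt hτs hd i i.hη.ne' hΩ hρ m ha Λ hU f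
  refine le_trans ?_ h
  have hff : 0 ≤ formE τ _ f f := formE_self_nonneg' hτp f
  refine mul_le_mul_of_nonneg_right ?_ hff
  -- compare the two constants: `wη ≤ M + 4ρ`
  have hmargin : (ρ : ℝ) * gs L i.k ≤ (L : ℝ) ^ i.k * (2 * ρ) := by exact_mod_cast margin_own (ρ := ρ) hL i.k
  have hLk : (0 : ℝ) < (L : ℝ) ^ i.k := by positivity
  have hw0 : (0 : ℝ) < (((L : ℤ) ^ i.k * Mc + 2 * ρ * gs L i.k : ℤ) : ℝ) * i.η := by
    have hgs : (1 : ℝ) ≤ gs L i.k := by exact_mod_cast one_le_gs L i.k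
    have hρ' : (1 : ℝ) ≤ ρ := by exact_mod_cast hρ
    push_cast
    have : (0 : ℝ) < (L : ℝ) ^ i.k * Mc + 2 * ρ * gs L i.k := by nlinarith [hLk.le]
    exact mul_pos this i.hη
  have hwle : (((L : ℤ) ^ i.k * Mc + 2 * ρ * gs L i.k : ℤ) : ℝ) * i.η ≤ (Mc : ℝ) + 4 * ρ := by
    push_cast
    have h1 : ((L : ℝ) ^ i.k * Mc + 2 * ρ * gs L i.k) ≤ ((Mc : ℝ) + 4 * ρ) * (L : ℝ) ^ i.k := by nlinarith [hmargin, (Nat.cast_nonneg Mc : (0 : ℝ) ≤ Mc)]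
    have hM4 : (0 : ℝ) ≤ (Mc : ℝ) + 4 * ρ := by positivity
    calc ((L : ℝ) ^ i.k * Mc + 2 * ρ * gs L i.k) * i.η ≤ ((Mc : ℝ) + 4 * ρ) * (L : ℝ) ^ i.k * i.η :=
          mul_le_mul_of_nonneg_right h1 i.hη.le
      _ = ((Mc : ℝ) + 4 * ρ) * (i.η * (L : ℝ) ^ i.k) := by ring
      _ ≤ ((Mc : ℝ) + 4 * ρ) * 1 := mul_le_mul_of_nonneg_left hηk hM4
      _ = (Mc : ℝ) + 4 * ρ := mul_one _
  have hsq : ((((L : ℤ) ^ i.k * Mc + 2 * ρ * gs L i.k : ℤ) : ℝ) * i.η) ^ 2 ≤ ((Mc : ℝ) + 4 * ρ) ^ 2 := pow_le_pow_left₀ hw0.le hwle 2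
  exact inv_anti₀ (pow_pos hw0 2) hsq

include hτt hτs in
/-- ★★★★ **`‖G′(U₀)f‖²_τ ≤ (M + 4ρ)⁴·‖f‖²_τ` AT EVERY CUBE MEMBER AND EVERY UNITARY BACKGROUND** — one constant for the whole cube family (`η·Lᵏ ≤ 1`, `L ≥ 2`, `1 ≤ ρ`).
[cite: Balaban1985BackgroundPropagators, Thm 3.1 p.397, (3.42) p.397; Balaban1984PropagatorsII, (2.22) p.226] -/
theorem formE_GpZd_self_le_cubeMember_uniform (hd : 0 < d) (hL : 2 ≤ L) (i : ZdIdx d L) {a : Site d} {Mc ρ : ℕ}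
    (hΩ : i.Ω = cubeFam false L a Mc ρ i.k) (hρ : 1 ≤ ρ) (hηk : i.η * (L : ℝ) ^ i.k ≤ 1) (m : ℕ) {a₀ : ℕ → ℝ} (ha : ∀ j, 0 ≤ a₀ j)
    (Λ : ℕ → Finset (Site d)) {U₀ : Site d → Fin d → 𝔸ˣ} (hU : ∀ (x : Site d) (κ : Fin d), U₀ x κ ∈ unitaryUnits 𝔸)
    (f : suppSub (𝔸 := 𝔸) (cubeMember_Ω0_finite i hΩ).toFinset) :
    formE τ _ (GpZd L U₀ i.η τ hτp m a₀ Λ (cubeMember_Ω0_finite i hΩ).toFinset hd i.hη.ne' hτt hτs hU ha f)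
        (GpZd L U₀ i.η τ hτp m a₀ Λ (cubeMember_Ω0_finite i hΩ).toFinset hd i.hη.ne' hτt hτs hU ha f) ≤
      ((((Mc : ℝ) + 4 * ρ) ^ 2)⁻¹)⁻¹ ^ 2 * formE τ _ f f := by
  have hpos : (0 : ℝ) < (((Mc : ℝ) + 4 * ρ) ^ 2)⁻¹ := by
    have hρ' : (1 : ℝ) ≤ ρ := by exact_mod_cast hρ
    positivity
  exact formE_GpZd_self_le_of_coercive τ hτp hτt hτs hd i.hη.ne' m ha Λ _ hU hpos
    (fun g => formE_deltaPrimeADom_coercive_cubeMember_uniform τ hτp hτt hτs hd hL i hΩ hρ hηk m ha Λ hU g) f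

include hτt hτs in
/-- ★★★★ **`Σ_ν Σ_x |(D^η_{U₀,ν}G′(U₀)f)(x)|²_τ ≤ (M + 4ρ)²·‖f‖²_τ` AT EVERY CUBE MEMBER AND EVERY UNITARY BACKGROUND** — one constant for the whole cube family.
[cite: Balaban1985BackgroundPropagators, Thm 3.1 p.397, (3.42) p.397 (n = 1); Balaban1984PropagatorsII, (2.22) p.226] -/
theorem gradEnergy_GpZd_le_cubeMember_uniform (hd : 0 < d) (hL : 2 ≤ L) (i : ZdIdx d L) {a : Site d} {Mc ρ : ℕ}
    (hΩ : i.Ω = cubeFam false L a Mc ρ i.k) (hρ : 1 ≤ ρ) (hηk : i.η * (L : ℝ) ^ i.k ≤ 1) (m : ℕ) {a₀ : ℕ → ℝ} (ha : ∀ j, 0 ≤ a₀ j)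
    (Λ : ℕ → Finset (Site d)) {U₀ : Site d → Fin d → 𝔸ˣ} (hU : ∀ (x : Site d) (κ : Fin d), U₀ x κ ∈ unitaryUnits 𝔸)
    (f : suppSub (𝔸 := 𝔸) (cubeMember_Ω0_finite i hΩ).toFinset) :
    ∑ ν : Fin d, ∑ᶠ x, (τ (star (covDerivFwd i.η U₀ ν (GpZd L U₀ i.η τ hτp m a₀ Λ (cubeMember_Ω0_finite i hΩ).toFinset hd i.hη.ne' hτt hτs hU ha f : Site d → 𝔸) x) *
        covDerivFwd i.η U₀ ν (GpZd L U₀ i.η τ hτp m a₀ Λ (cubeMember_Ω0_finite i hΩ).toFinset hd i.hη.ne' hτt hτs hU ha f : Site d → 𝔸) x)).re ≤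
      (((Mc : ℝ) + 4 * ρ) ^ 2)⁻¹⁻¹ * formE τ _ f f := by
  have hpos : (0 : ℝ) < (((Mc : ℝ) + 4 * ρ) ^ 2)⁻¹ := by
    have hρ' : (1 : ℝ) ≤ ρ := by exact_mod_cast hρ
    positivity
  exact gradEnergy_GpZd_le_of_coercive τ hτp hτt hτs hd i.hη.ne' m ha Λ _ hU hpos
    (fun g => formE_deltaPrimeADom_coercive_cubeMember_uniform τ hτp hτt hτs hd hL i hΩ hρ hηk m ha Λ hU g) f

end CubeMember

end Literature.MathematicalPhysics.QuantumFieldTheory.Balaban1983to89.B9Thm31FriedrichsCoerciveZd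

end
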